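import Mathlib
import Literature.Geometry.Riemannian.IsotropicCurvature
import Literature.Geometry.Riemannian.ConformallyFlat
import Literature.Geometry.Lorentzian.LeviCivita
import HarnessLib

/-!
# Named facts: PIC and conformally flat sphere theorems in dimension 4

Grounder file (D-0014 named facts) for the route `SmoothPoincare4/PIC` (assembly items
stmt-SmoothPoincare4-0474 and -0477 take these two facts verbatim as hypotheses).

* `Literature.Geometry.Riemannian.hamilton_pic_sphere_four` — a closed simply connected smooth 4-manifold carrying a
  Riemannian metric of positive isotropic curvature is diffeomorphic to `S⁴`.
  Source: this is verbatim Hamilton, Comm. Anal. Geom. 5 (1997) 1–92, **Corollary 1.2(a)** (p. 3):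
  "If `M⁴` is a compact four-manifold with positive isotropic curvature, then (a) if `π₁ = {1}`,
  `M⁴` is diffeomorphic to `S⁴`", a corollary of the Main Theorem 1.1 (p. 2): "Let `M⁴` be a
  compact four-manifold with no essential incompressible space-form. Then `M⁴` admits a metric of
  positive isotropic curvature if and only if `M⁴` is diffeomorphic to the sphere `S⁴`, the
  projective space `RP⁴`, the product `S³ × S¹`, the twisted product `S³ ×~ S¹` which is the only
  unoriented `S³` bundle over `S¹`, or a connected sum of the above" (PIC defined on p. 2 by
  `R₁₃₁₃ + R₁₄₁₄ + R₂₃₂₃ + R₂₄₂₄ > 2 R₁₂₃₄` for every orthonormal 4-frame — the frame form of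
  `HasPositiveIsotropicCurvature`). The surgery part of Hamilton's proof (§5) was completed by
  Chen–Zhu, J. Differential Geom. 74 (2006) 177–264, Thm. 1.1 and Cor. 1.2; the statement is
  reprinted in Chen–Tang–Zhu, J. Differential Geom. 91 (2012), §1, "Theorem (Hamilton)", with the
  remark that the space-form condition "is automatically satisfied if `π₁(M)` is torsion free".
  (For `π₁(M) = 1`: an incompressible space form `S³/Γ` has `Γ ↪ π₁(M) = 1`, so none is
  essential; `π₁` of a connected sum of 4-manifolds is the free product of the `π₁`'s — `ℤ₂` for
  `RP⁴`, `ℤ` for the two `S³`-bundles over `S¹` — so only `S⁴` summands occur and `M ≅ S⁴`, which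
  is how Cor. 1.2(a) follows from Thm. 1.1.) Proof: Ricci flow with surgery (Hamilton 1997
  §§2–5, Chen–Zhu 2006 §§2–5), far beyond the tree at this pin — no discharge
  `hamilton_pic_sphere_four_holds` exists; the natural decomposition along the printed proof is
  "Thm. 1.1 with `π₁ = 1`: `M` is a connected sum of finitely many copies of `S⁴`" followed by
  Kervaire–Milnor's `S⁴ # S⁴ ≅ S⁴` (Ann. of Math. 77 (1963), Lemma 2.1). The same statement is
  also vended, with the same encoding, as `Literature.Geometry.Riemannian.hamilton_chen_tang_zhu`
  (`Literature/Geometry/Riemannian/HamiltonPIC.lean`).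
* `Literature.Geometry.Riemannian.kuiper_conformallyFlat_sphere_four` — a closed simply connected smooth 4-manifold
  carrying a locally conformally flat Riemannian metric is diffeomorphic to `S⁴`.
  Source: Kuiper, Ann. of Math. 50 (1949) 916–924 (main theorem: "every compact simply connected
  conformally flat Riemannian manifold is conformally equivalent to the round sphere" — the
  developing map `M → Sⁿ` is a conformal diffeomorphism); restated in Schoen–Yau, Invent. Math.
  92 (1988), §1. We record only the diffeomorphism.

Encoding: manifolds are `M : Type` with `[ChartedSpace (EuclideanSpace ℝ (Fin 4)) M]`,
`[IsManifold (𝓡 4) ∞ M]`, closed = `T2Space ∧ SecondCountableTopology ∧ CompactSpace`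
(boundaryless model `𝓡 4`), simply connected = Mathlib `SimplyConnectedSpace` (path connected with
trivial fundamental groupoid automorphisms); metrics are `Literature.Geometry.Lorentzian.PseudoRiemannianMetric` on
the tangent bundle with `IsRiemannian`; PIC is `HasPositiveIsotropicCurvature`
(`IsotropicCurvature.lean`, Micallef–Moore 1988 §1), conformal flatness is
`IsLocallyConformallyFlat` (`ConformallyFlat.lean`, Besse 1.159). Nothing is asserted; users take
`(h : <name>)`.
-/

noncomputable section

open scoped Manifold ContDiff
open ContinuousMap

namespace Literature.Geometry.Riemannian

/-- NAMED FACT (**Hamilton 1997, Corollary 1.2(a)** (p. 3) of the Main Theorem 1.1 (p. 2): "If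
`M⁴` is a compact four-manifold with positive isotropic curvature, then (a) if `π₁ = {1}`, `M⁴` is
diffeomorphic to `S⁴`"; surgery argument completed by Chen–Zhu 2006, Thm. 1.1 / Cor. 1.2;
restated in Chen–Tang–Zhu 2012, §1 "Theorem (Hamilton)" with the remark that the
no-essential-incompressible-space-form hypothesis is automatic for torsion-free `π₁`). A closed,
simply connected, smooth 4-manifold admitting a Riemannian metric of positive isotropic curvature
is diffeomorphic to the standard sphere `S⁴ ⊂ ℝ⁵`. Users take `(h : hamilton_pic_sphere_four)`.
[cite: Hamilton1997, Cor. 1.2(a) (p. 3) of Thm. 1.1 (p. 2)] [cite: ChenZhu2006, Thm. 1.1 and Cor. 1.2] [cite: ChenTangZhu2012, §1 (Theorem (Hamilton) and the torsion-free remark)] -/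
def hamilton_pic_sphere_four : Prop :=
  ∀ (M : Type) [TopologicalSpace M] [T2Space M] [SecondCountableTopology M]
    [ChartedSpace (EuclideanSpace ℝ (Fin 4)) M] [IsManifold (𝓡 4) ∞ M] [CompactSpace M]
    [SimplyConnectedSpace M],
    (∃ g : Literature.Geometry.Lorentzian.PseudoRiemannianMetric (𝓡 4) ∞ (EuclideanSpace ℝ (Fin 4))
        (TangentSpace (𝓡 4) : M → Type _), g.IsRiemannian ∧ g.HasPositiveIsotropicCurvature) →
      Nonempty (M ≃ₘ⟮𝓡 4, 𝓡 4⟯ Metric.sphere (0 : EuclideanSpace ℝ (Fin 5)) 1)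

/-- NAMED FACT (Kuiper 1949, main theorem, dimension 4; cf. Schoen–Yau 1988 §1). A closed, simply
connected, smooth 4-manifold admitting a locally conformally flat Riemannian metric is
diffeomorphic to the standard sphere `S⁴ ⊂ ℝ⁵` (Kuiper: it is even conformally equivalent to the
round sphere, via the developing map). Users take `(h : kuiper_conformallyFlat_sphere_four)`.
[cite: Kuiper1949, main theorem (compact simply connected case)] [cite: SchoenYau1988, §1] -/
def kuiper_conformallyFlat_sphere_four : Prop :=
  ∀ (M : Type) [TopologicalSpace M] [T2Space M] [SecondCountableTopology M]
    [ChartedSpace (EuclideanSpace ℝ (Fin 4)) M] [IsManifold (𝓡 4) ∞ M] [CompactSpace M]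
    [SimplyConnectedSpace M],
    (∃ g : Literature.Geometry.Lorentzian.PseudoRiemannianMetric (𝓡 4) ∞ (EuclideanSpace ℝ (Fin 4))
        (TangentSpace (𝓡 4) : M → Type _), g.IsRiemannian ∧ g.IsLocallyConformallyFlat) →
      Nonempty (M ≃ₘ⟮𝓡 4, 𝓡 4⟯ Metric.sphere (0 : EuclideanSpace ℝ (Fin 5)) 1)

end Literature.Geometry.Riemannian

end
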